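import Summits.FinalStateConjecture.FinalStateConjecture.Theses.ZeroEnergyKerrOrBomb
import Summits.FinalStateConjecture.FinalStateConjecture.Theorems.ZeroEnergyKerrOrBombKerrOrBombOfCruxes
import Summits.FinalStateConjecture.FinalStateConjecture.Theorems.ErgoregionBomb.Negative.TrappingClauseVacuous

/-!
# Dock check (card `typed-crux-docks-on-siblings`, crux KerrOrBomb = stmt-FinalStateConjecture-10689)

Kernel check of the composition claimed in the card: the TYPED `KerrOrBomb` follows from `ZeroEnergyRigidity`
(crux 10690) alone, given the two causality facts of the tree and the endlessness of affine rays (`hEnd`), because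
`ErgoregionBomb` is then vacuously true and `KerrOrBombOfCruxes` is proved. No mode stability is used anywhere.
-/

noncomputable section

namespace Summit.FinalStateConjecture.FinalStateConjecture.Cruxes.KerrOrBomb.Dock

open Literature.Geometry.Lorentzian
open Summit.FinalStateConjecture.FinalStateConjecture.Theses.ZeroEnergyKerrOrBomb
open Summit.FinalStateConjecture.FinalStateConjecture.Theorems
open scoped Manifold

set_option linter.dupNamespace false

/-- `ErgoregionBomb` as typed, from three crux-independent facts (two tree facts + `hEnd`). [folklore] -/
theorem ergoregionBomb_of_facts
    (hBS : ∀ (𝓑 : StationaryAFBlackHole.{0}) (τ : TimeOrientation 𝓑.metric),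
      𝓑.metric.bernalSanchez_isStronglyCausal_of_isGloballyHyperbolic τ)
    (hNI : ∀ (𝓑 : StationaryAFBlackHole.{0}) (τ : TimeOrientation 𝓑.metric),
      LorentzianMetric.IsStronglyCausal.exists_forall_notMem_of_isCompact 𝓑.metric τ)
    (hEnd : ∀ (𝓑 : StationaryAFBlackHole.{0}) [𝓑.metric.HasLeviCivita] (γ : ℝ → 𝓑.carrier),
      IsGeodesicOn 𝓑.metric.leviCivita γ (Set.Ici 0) →
      (∀ s : ℝ, 0 ≤ s → velocity (𝓡 4) γ s ≠ 0) → IsFutureEndless γ (Set.Ici 0)) :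
    ErgoregionBomb := by
  intro 𝓑 _ _ _ _ _ hgh _ γ K hg hz hK _ hin
  exact absurd trivial fun _ ↦
    ErgoregionBomb.Negative.trapping_clause_contradictory 𝓑 (hBS 𝓑) (hNI 𝓑) (hEnd 𝓑) hgh hg
      (fun s hs ↦ (hz s hs).1) hK hin

/-- **The dock.** Typed `KerrOrBomb` from `ZeroEnergyRigidity` and the three facts. [folklore] -/
theorem kerrOrBomb_of_zeroEnergyRigidity
    (hBS : ∀ (𝓑 : StationaryAFBlackHole.{0}) (τ : TimeOrientation 𝓑.metric),
      𝓑.metric.bernalSanchez_isStronglyCausal_of_isGloballyHyperbolic τ)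
    (hNI : ∀ (𝓑 : StationaryAFBlackHole.{0}) (τ : TimeOrientation 𝓑.metric),
      LorentzianMetric.IsStronglyCausal.exists_forall_notMem_of_isCompact 𝓑.metric τ)
    (hEnd : ∀ (𝓑 : StationaryAFBlackHole.{0}) [𝓑.metric.HasLeviCivita] (γ : ℝ → 𝓑.carrier),
      IsGeodesicOn 𝓑.metric.leviCivita γ (Set.Ici 0) →
      (∀ s : ℝ, 0 ≤ s → velocity (𝓡 4) γ s ≠ 0) → IsFutureEndless γ (Set.Ici 0))
    (h10690 : ZeroEnergyRigidity) : KerrOrBomb :=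
  KerrOrBombOfCruxes_proof h10690 (ergoregionBomb_of_facts hBS hNI hEnd)

end Summit.FinalStateConjecture.FinalStateConjecture.Cruxes.KerrOrBomb.Dock
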